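import Literature.MathematicalPhysics.QuantumFieldTheory.Balaban1983to89.B6Prop22MultiLevelBoxL0
import Literature.MathematicalPhysics.QuantumFieldTheory.Balaban1983to89.B6Ineq243TwoLevelBoxL0
import Literature.MathematicalPhysics.QuantumFieldTheory.Balaban1983to89.B6Prop22DerivMultiLevelBox
/-!
# `Balaban1983to89.B6Prop22DerivMultiLevelBoxL0` — LEVEL-0 TWIN (programme G-F3′-L0, director-ym LINE №27 / UV3-NODE §24.5; plan `lit-balaban-r03/G-F3L0-PLAN.md`) of `B6Prop22DerivMultiLevelBox`:
the same declarations, SAME NAMES AND STATEMENTS, for nested families WITH print's region `Λ₀ = T ∖ Ω₁` ADMITTED (structures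
`B6MultiLevelBoxOperatorL0.Domains` / `B6MultiLevelTorusOperatorL0.TDomains`: levels `0, …, k`, the level-`0` block a single site, `Q′₀ = id`,
finite weight `a₀` — print p.225 (2.14) «Σ_{j=0}^k … (Q′₀λ)(x) = λ(x), x ∈ Λ₀», p.229 «taking a sequence (2.1) … smallest possible domains B^j(Λ_j),
and considering the operator Δ_a defined by (2.19), (2.20) for this sequence»).  Every `D`-free object is the lineage's, consumed BY NAME; no existing
module is touched; no fact is minted.  Unit `lit-balaban-p21` (packet S-B owner, p21 gen 26; port tooling by r03 gen 36); B6 fold owner r03; referee ref-4.  THE TWIN'S DOCUMENTATION FOLLOWS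
VERBATIM (its «levels 1 … k» / «Ω₁ = X» sentences describe the twin; here `j` runs from `0` and `Ω₁` may be a proper subset).

# `Balaban1983to89.B6Prop22DerivMultiLevelBox` — [B6] PROPOSITION 2.2, SECOND ENTRY OF (2.67) (`|∇^η_x G′λ|`), FOR
THE GENUINE `k`-LEVEL OPERATOR `G′ = Δ′_a^{−1}` ON A BOX: `|(∇^ηG′λ)(x)| ≤ O(1)L^jη·e^{−½δ₀d(y,y′)}|λ|`,
`x ∈ B^j(y)`, `supp λ ⊂ B^{j′}(y′)` — by the printed route (2.64)–(2.66) applied to the differentiated fixed point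
`∂G′ = ∂G′₀ + (∂G′)R` (file 6 of the multi-level parametrix; no existing module is touched; no fact is minted)

FRAMING (verbatim cell line):
statement-level skeleton of published theorems with citation tags; proofs where landed; nothing here is a claim about the Yang–Mills mass gap

Source under audit (cell pub-balaban / lit-balaban): T. Bałaban, *Propagators and renormalization transformations for
lattice gauge theories. II*, Commun. Math. Phys. **96** (1984) 223–250 [`Balaban1984PropagatorsII`, "B6"], p. 234
[PDF 12] (2.64)–(2.67), Proposition 2.2; p. 230 [PDF 8] (2.43) (render
`run/shared/lean/pub/pub-balaban/b2b-balaban-ref1/pages/1984-cmp96-propagators-rt-II/…-p008/p012-x2.png`, read as images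
this generation).  Unit `lit-balaban-p21` (Phase-2 proof seat p21 gen 10), HOME `run/shared/lean/pub/lit-balaban/`,
B6 fold owner r03, referee ref-4.

## WHAT IS PRINTED (p. 234, verbatim up to notation)

«**Proposition 2.2.** If we have (2.1), (2.2) and M is sufficiently large, then the operator G′ = Δ′_a^{−1} (a = 1)
satisfies the inequalities |(G′λ)(x)|, |(∇^η_xG′λ)(x)|, … ≤ O(1)[(L^jη)², L^jη, …]·e^{−½δ₀d(y,y′)}|λ|, x ∈ B^j(y) …,
y ∈ Λ_j, supp λ ⊂ B^{j′}(y′), y′ ∈ Λ_{j′}. (2.67)»; p. 230: «Properties of the operators G′_j(□), G′_j(□)Q′_j*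
and C_Λ^{(j)}(□) are described in Lemmas 2.2, 2.4, Proposition 2.3 [3]. From these and (2.42) we get» (2.43), which
lists `|(∂^{L^{−j}}_μG′(□)λ)(x)|` among the cube estimates (docfix: the sentence of p. 230 quoted verbatim, referee NOTE
S-B6-g41-2; no declaration changed).

## WHAT THIS FILE CERTIFIES (kernel-checked; setting of files 1–5)

For the genuine `k`-level operator `Δ′_a = mlOp` of a nested family `D : Domains d ℓ M_h k P R` on the box, the cover
`𝒟`, `G′₀ = gZeroML`, `R = rML` (file 2), `G′ = gml` (file 1), the blocks `𝔅`/`blkOf`/distance `d` of `geom D`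
(file 4), in the majorant language of `B6RandomWalk`:
* §2 the forward unit difference `∂_μ` on the box as a matrix `dMat` (Neumann: zero where `x + e_μ` leaves the box;
  `∇^η = η^{−1}∂` in lattice units), `dMat_mulVec_of_mem/_of_not_mem`;
* §3 cube geometry for a lattice bond: if `h_□(z) ≠ 0` then `z` and its box neighbours lie in the cube (the [3] (2.6)
  margin, `B6Eq238TwoLevelBox.hΩ_support`/`exists_emb_eq_of_nbr`) (`img_of_uX_ne_zero`); the finite overlap at a
  point from `h_□(z) ≠ 0` (`mem_keySet_of_uX_ne_zero`);
* §4 **THE MAJORANT OF `∂G′₀`** `dMat_gZeroML_majorant`: `A·L^{j}·e^{−δ₃d(y,y′)/(d+1)}` (`y ∈ Λ_j`, `j` = the level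
  of `x`) — per term `h_□G′(□)v_□λ` by the product rule
  `∂(h_□·G′(□)v_□λ)(x) = (∂h_□)(x)·(G′(□)v_□λ)(x + e_μ) + h_□(x)·(∂G′(□)v_□λ)(x)`, with `|∂h_□| ≤ (d+1)D₁/L^{j_□}`
  (`B6Partition236TwoLevelBox.abs_hq_sub_le`), (2.43)₁ at `x + e_μ` (`ineq243_twoLevel_roww`,
  `B4Thm110ZeroBox.mulVec_le_of_roww`) and (2.43)₂ (`B6Ineq243TwoLevelBox.ineq243_twoLevel_deriv_wsum`) in its
  decaying form against block-supported vectors, the lattice-unit factors `L^{2i_□}/L^{j_□} ≤ L^{i_□} ≤ L^j`,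
  `L^{i_□} ≤ L^j`, the support distance read from `d` (file 5 §2) and at most `6·2^{d+1}` terms;
* §5 **PROPOSITION 2.2, SECOND ENTRY, FOR THE GENUINE `k`-LEVEL OPERATOR** `prop22_second_multiLevelBox`: there are
  `δ₀, C, M₀ > 0` and `N₀` (functions of `d`, `ℓ`, windows) such that for every `k`, `M_h ≥ 3` with `L·M_h ≥ M₀`,
  `R ≥ 2L` with `R·M ≥ N₀ + 1`, every volume, nested family `D`, weights in the windows with
  `a_{i+1} = aNext ℓ a_i c_i`, and every axis `μ`:
  `|(G′λ)(x + e_μ) − (G′λ)(x)| ≤ C·L^{j}·e^{−½δ₀d(y,y′)}|λ|` for `x, x + e_μ` in the box, `x ∈ B^j(y)`,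
  `supp λ ⊂ B^{j′}(y′)` (`HasMajorant (blkOf D) (toLin' (dMat μ * gml))`) — the differentiated fixed point
  `∂G′ = ∂G′₀ + (∂G′)R` (`fixedPoint_dMat_gml`), the `R`-majorant (2.64) of file 5 (`rML_majorant`), §4, Lemma 2.1 on
  the box (file 4) and the chain `B6Prop23Chain.majorant_of_fixedPoint_266W`.

## HONEST SCOPE

As files 1–5: levels `1 … k` on a Neumann box, `m² = 0`, the asymmetric partition, `M_h ≥ 3`; lattice units (`G′` here
is `η^{−2}G′` of print and `∂ = η∇^η`, whence `L^{j}` for «L^jη»); the (2.61)-constant is the `L`-dependent series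
constant of `B6Ineq261LevelGap`; constants existential; the level `j` is that of the base point `x` of the bond.
Nothing is inferred from the manuscript: every step is kernel-checked.
-/

namespace Literature.MathematicalPhysics.QuantumFieldTheory.Balaban1983to89.B6Prop22DerivMultiLevelBoxL0

open Finset Matrix
open Literature.MathematicalPhysics.QuantumFieldTheory.Balaban1983to89.B4ContourShift (supNorm abs_le_supNorm
  supNorm_nonneg)
open Literature.MathematicalPhysics.QuantumFieldTheory.Balaban1983to89.B4Reflection242 (boxDom mem_boxDom blk nbrs
  mem_nbrs)
open Literature.MathematicalPhysics.QuantumFieldTheory.Balaban1983to89.B4Lemma22ReduceZero (Box)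
open Literature.MathematicalPhysics.QuantumFieldTheory.Balaban1983to89.B4PartitionUnity22 (hprof D1 D2 D1_nonneg D2_nonneg
  contDiff_hprof hasCompactSupport_hprof)
open Literature.MathematicalPhysics.QuantumFieldTheory.Balaban1983to89.B4Thm110ZeroBox (boxCast boxCast_apply_val
  boxCast_symm_apply_val mem_boxDom_of_eq roww mulVec_le_of_roww)
open Literature.MathematicalPhysics.QuantumFieldTheory.Balaban1983to89.B4Thm110ZeroBoxDeriv (supNorm_single_le
  supNorm_sub_le_nbr)
open Literature.MathematicalPhysics.QuantumFieldTheory.Balaban1983to89.B6Ineq243TwoLevelBox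
open Literature.MathematicalPhysics.QuantumFieldTheory.Balaban1983to89.B6Partition236TwoLevelBox
open Literature.MathematicalPhysics.QuantumFieldTheory.Balaban1983to89.B6Eq238TwoLevelBox
open Literature.MathematicalPhysics.QuantumFieldTheory.Balaban1983to89.B6Ineq249TwoLevelBox (near card_near_le
  mem_near_of_abs_lt emb_sub_emb)
open Literature.MathematicalPhysics.QuantumFieldTheory.Balaban1983to89.B6MultiLevelBoxOperator hiding Domains mlOp_apply
open Literature.MathematicalPhysics.QuantumFieldTheory.Balaban1983to89.B6MultiLevelBoxOperatorL0
open Literature.MathematicalPhysics.QuantumFieldTheory.Balaban1983to89.B6Eq238MultiLevelBox hiding Active CubeData Down Ep LamG aX bX cG cOp cOp_mul_cG ctrs_Pj_subset cubeData_of_mem cubeSet diagonal_mul_eq_pad eq238_multiLevelBox fin fin_data fin_spec gX gZeroML isBlockUnion_LamG lev_corner_ublk mem_LamG mem_cubeSet mlOp_emb_emb mlOp_emb_off mlOp_mul_aX mlOp_mul_term rML row_eq_pad_row sum_uv_eq_one vFun vX window_of_active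
open Literature.MathematicalPhysics.QuantumFieldTheory.Balaban1983to89.B6Eq238MultiLevelBoxL0
open Literature.MathematicalPhysics.QuantumFieldTheory.Balaban1983to89.B6Ineq249MultiLevelBox hiding abs_vFun_le_one bX_eq bX_mulVec_apply embC eq250_multiLevelBox innerB local_comm_bound mem_keySet_of_bX_ne_zero norm_rML_le
open Literature.MathematicalPhysics.QuantumFieldTheory.Balaban1983to89.B6Ineq249MultiLevelBoxL0
open Literature.MathematicalPhysics.QuantumFieldTheory.Balaban1983to89.B6Geom246MultiLevelBox hiding Touch blkOf blkOf_corner blkOf_eq_iff_blk blkOf_eq_of_blk_i_eq blkOf_val bond bond_adj bset cen connected coord_bounds corner corner_mem csys dist_blkOf_le_box dist_blkOf_le_coord dist_blkOf_le_line dist_cen_le_of_adj dist_cen_le_of_touch dist_le_one_of_near dist_toR_cen_le exists_blkOf_eq geom lemma21_box lev_corner lev_eq_of_blkOf_eq levelGap pack reachable_blkOf reachable_of_near realizes scale_bounds touch_symm triangle_refl_nonneg walk_disp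
open Literature.MathematicalPhysics.QuantumFieldTheory.Balaban1983to89.B6Geom246MultiLevelBoxL0
open Literature.MathematicalPhysics.QuantumFieldTheory.Balaban1983to89.B6Prop22MultiLevelBox hiding Dd_le_supNorm aX_mulVec_apply bX_row_img bX_row_off dist_blkOf_le_in_cube fixedPoint_gml gX_row_img gX_row_off gZeroML_majorant lev_window_of_inCube mem_keySet_of_aX_ne_zero prop22_first_multiLevelBox rML_majorant
open Literature.MathematicalPhysics.QuantumFieldTheory.Balaban1983to89.B6Prop22MultiLevelBoxL0
open Literature.MathematicalPhysics.QuantumFieldTheory.Balaban1983to89.B6RandomWalk (HasMajorant BlockSupp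
  hasMajorant_mono)
open Literature.MathematicalPhysics.QuantumFieldTheory.Balaban1983to89.B6Ineq261LevelGap (K261 K261_nonneg
  theta_lt_one_of_log)
open Literature.MathematicalPhysics.QuantumFieldTheory.Balaban1983to89.B6Prop23Chain (majorant_of_fixedPoint_266W)

open Literature.MathematicalPhysics.QuantumFieldTheory.Balaban1983to89.B6Prop22DerivMultiLevelBox (dMat dMat_mulVec_of_mem dMat_mulVec_of_not_mem)
noncomputable section

variable {d : ℕ}

/-! ## §1 Tools -/

section Tools

/-- a sum over a finite type whose non-zero terms are indexed injectively into a finset `T` and are bounded by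
`B ≥ 0` is at most `|T|·B`. [folklore] -/
private theorem sum_le_card_mul {ι σ : Type*} [Fintype ι] [DecidableEq σ] (f : ι → ℝ) (key : ι → σ)
    (hkey : Function.Injective key) (T : Finset σ) (hT : ∀ i, f i ≠ 0 → key i ∈ T) {B : ℝ} (hB : 0 ≤ B)
    (hf : ∀ i, f i ≤ B) : ∑ i, f i ≤ T.card * B := by
  classical
  rw [← Finset.sum_filter_ne_zero]
  have hcard : (Finset.univ.filter fun i => f i ≠ 0).card ≤ T.card :=
    Finset.card_le_card_of_injOn key (fun i hi => by
      rw [Finset.coe_filter] at hi; exact hT i hi.2) (fun i _ j _ h => hkey h)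
  calc ∑ i ∈ Finset.univ.filter (fun i => f i ≠ 0), f i
      ≤ (Finset.univ.filter fun i => f i ≠ 0).card • B := Finset.sum_le_card_nsmul _ _ _ fun i _ => hf i
    _ = ((Finset.univ.filter fun i => f i ≠ 0).card : ℝ) * B := by rw [nsmul_eq_mul]
    _ ≤ T.card * B := mul_le_mul_of_nonneg_right (by exact_mod_cast hcard) hB

/-- a weighted `ℓ¹` row bound gives decay against bounded vectors supported at sup-distance `≥ D` from the base point
(the vector analogue of `B4Thm110ZeroBox.mulVec_le_of_roww`). [folklore] -/
private theorem sum_mul_le_of_wrow {X : Type*} [Fintype X] {δ n c F Dd : ℝ} (hn : 0 < n) (hF0 : 0 ≤ F)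
    (r u : X → ℝ) (dist : X → ℝ) (hrow : ∑ z, |r z| * Real.exp (δ * dist z / n) ≤ c)
    (hF : ∀ z, |u z| ≤ F) (hD : ∀ z, u z ≠ 0 → Dd ≤ dist z) (hδ : 0 ≤ δ) :
    |∑ z, r z * u z| ≤ c * Real.exp (-(δ * Dd / n)) * F := by
  have hterm : ∀ z, |r z * u z| ≤ |r z| * Real.exp (δ * dist z / n) * (Real.exp (-(δ * Dd / n)) * F) := by
    intro z
    by_cases hz : u z = 0
    · rw [hz, mul_zero, abs_zero]; positivity
    rw [abs_mul]
    have h1 : 1 ≤ Real.exp (δ * dist z / n) * Real.exp (-(δ * Dd / n)) := by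
      rw [← Real.exp_add]
      refine Real.one_le_exp ?_
      have := div_le_div_of_nonneg_right (mul_le_mul_of_nonneg_left (hD z hz) hδ) hn.le
      linarith
    calc |r z| * |u z| ≤ |r z| * (1 * F) := by
          rw [one_mul]; exact mul_le_mul_of_nonneg_left (hF z) (abs_nonneg _)
      _ ≤ |r z| * (Real.exp (δ * dist z / n) * Real.exp (-(δ * Dd / n)) * F) :=
          mul_le_mul_of_nonneg_left (mul_le_mul_of_nonneg_right h1 hF0) (abs_nonneg _)
      _ = |r z| * Real.exp (δ * dist z / n) * (Real.exp (-(δ * Dd / n)) * F) := by ring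
  calc |∑ z, r z * u z| ≤ ∑ z, |r z * u z| := Finset.abs_sum_le_sum_abs _ _
    _ ≤ ∑ z, |r z| * Real.exp (δ * dist z / n) * (Real.exp (-(δ * Dd / n)) * F) :=
        Finset.sum_le_sum fun z _ => hterm z
    _ = (∑ z, |r z| * Real.exp (δ * dist z / n)) * (Real.exp (-(δ * Dd / n)) * F) := by rw [Finset.sum_mul]
    _ ≤ c * (Real.exp (-(δ * Dd / n)) * F) := mul_le_mul_of_nonneg_right hrow (by positivity)
    _ = c * Real.exp (-(δ * Dd / n)) * F := by ring

/-- the exponent bookkeeping: `e^{−δD/L^i} = e^{δ}·e^{−(δ/(d+1))·dist}` for `D = L^i(dist/(d+1) − 1)`. [folklore] -/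
private theorem exp_Dd_eq {δ n dist : ℝ} (hn : 0 < n) (d : ℕ) :
    Real.exp (-(δ * (n * (dist / (d + 1) - 1)) / n)) = Real.exp δ * Real.exp (-(δ / (d + 1) * dist)) := by
  rw [← Real.exp_add]
  congr 1
  field_simp
  ring

/-- the shift by one lattice step: `e^{−δ(D−1)/n} ≤ e^{δ}·e^{−δD/n}` for `n ≥ 1`, `δ ≥ 0`. [folklore] -/
private theorem exp_shift_le {δ n Dd : ℝ} (hδ : 0 ≤ δ) (hn : 1 ≤ n) :
    Real.exp (-(δ * (Dd - 1) / n)) ≤ Real.exp δ * Real.exp (-(δ * Dd / n)) := by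
  rw [← Real.exp_add, Real.exp_le_exp]
  have hn0 : 0 < n := by linarith
  have h1 : -(δ * (Dd - 1) / n) = -(δ * Dd / n) + δ / n := by
    field_simp
    ring
  rw [h1]
  have : δ / n ≤ δ := div_le_self hδ hn
  linarith

/-- the weakening of a rate against a non-negative distance. [folklore] -/
private theorem exp_rate_mono {δ δ' dist : ℝ} (hδ : δ' ≤ δ) (hdist : 0 ≤ dist) (d : ℕ) :
    Real.exp (-(δ / (d + 1) * dist)) ≤ Real.exp (-(δ' / (d + 1) * dist)) := by
  rw [Real.exp_le_exp, neg_le_neg_iff]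
  exact mul_le_mul_of_nonneg_right (div_le_div_of_nonneg_right hδ (by positivity)) hdist

end Tools

/-! ## §2 The forward unit difference on the box -/

section Diff

variable {N : Fin (d + 1) → ℕ}

end Diff

/-! ## §3 Cube geometry for a lattice bond -/

section CubeNbr

variable {ℓ Mh k R : ℕ} {P : Fin (d + 1) → ℕ} {D : Domains d ℓ Mh k P R} {a c : ℕ → ℝ}

/-- **THE [3] (2.6) MARGIN**: if `h_□(z) ≠ 0` then `z` and every box neighbour of `z` lie in the cube image.
[cite: Balaban1983RegularityDecay, (2.6) p.576; Balaban1984PropagatorsII, (2.36)–(2.37) p.229] -/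
theorem img_of_uX_ne_zero (hℓ : 1 ≤ ℓ) (hP : ∀ μ, 1 ≤ P μ) (hMh : 2 ≤ Mh) (cq : ℕ × (Fin (d + 1) → ℤ))
    (hc : CubeData D cq) {z w : ↥(boxDom (N0 ℓ Mh k P))}
    (hu : uX (ℓ := ℓ) (Mh := Mh) (k := k) (P := P) cq z ≠ 0) (hw : w.1 ∈ nbrs z.1 ∨ w = z) :
    ∃ b, embC D hP cq hc b = (castP (ℓ := ℓ) (Mh := Mh) (P := P) (fin_data hc).2.1 hc.hj.2).symm w := by
  obtain ⟨-, hij, hji, -, -⟩ := fin_data hc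
  have hjk := hc.hj.2
  have hzP : z.1 ∈ Box d ℓ (fin D cq.1 cq.2)
      (fun μ => (ℓ + 1) * (MhP ℓ Mh cq.1 (fin D cq.1 cq.2) * Pj ℓ k P cq.1 μ)) :=
    mem_boxDom_of_eq (Np_eq hij hjk).symm z.2
  have hΩz : hΩ ℓ (fin D cq.1 cq.2) (MhP ℓ Mh cq.1 (fin D cq.1 cq.2)) (Pj ℓ k P cq.1) cq.2 ⟨z.1, hzP⟩ ≠ 0 := by
    rw [← uFun_eq_hΩ hij cq.2 ⟨z.1, hzP⟩]; exact hu
  obtain ⟨a0, ha0, hIL⟩ := hΩ_support' (four_le_scale hℓ (show 2 ≤ MhP ℓ Mh cq.1 (fin D cq.1 cq.2) from le_trans hMh (Nat.le_mul_of_pos_right _ (by positivity)))) (one_le_Pj hP cq.1) hc.hq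
    ⟨z.1, hzP⟩ hΩz
  have hzeq : (castP (ℓ := ℓ) (Mh := Mh) (P := P) hij hjk).symm z = ⟨z.1, hzP⟩ :=
    Subtype.ext (by unfold castP; exact boxCast_symm_apply_val _ _)
  rcases hw with hw | rfl
  · have hwval : ((castP (ℓ := ℓ) (Mh := Mh) (P := P) hij hjk).symm w).1 = w.1 := by
      unfold castP; exact boxCast_symm_apply_val _ _
    have hw' : ((castP (ℓ := ℓ) (Mh := Mh) (P := P) hij hjk).symm w).1
        ∈ nbrs (B6Eq238TwoLevelBox.emb ℓ (fin D cq.1 cq.2) (MhP ℓ Mh cq.1 (fin D cq.1 cq.2)) (Pj ℓ k P cq.1) cq.2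
          (one_le_Pj hP cq.1) hc.hq a0).1 := by
      rw [ha0, hwval]; exact hw
    exact exists_emb_eq_of_nbr (one_le_Pj hP cq.1) hc.hq hIL hw'
  · exact ⟨a0, ha0.trans hzeq.symm⟩

/-- the finite overlap at a point from `h_□(z) ≠ 0`: the member `(j, q)` has `j ∈ {lev z − 1, lev z, lev z + 1}` and
`q` among the `2^{d+1}` candidate centres at `z` (file 5 `mem_keySet_of_aX_ne_zero`, from `h_□(z) ≠ 0` directly).
[cite: Balaban1984PropagatorsII, p.229 (cover of finite overlap)] -/
theorem mem_keySet_of_uX_ne_zero (hℓ : 1 ≤ ℓ) (hR : 2 * (ℓ + 1) ≤ R) (hP : ∀ μ, 1 ≤ P μ) (hMh : 2 ≤ Mh)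
    (cq : ℕ × (Fin (d + 1) → ℤ)) (hc : CubeData D cq) {z : ↥(boxDom (N0 ℓ Mh k P))}
    (hu : uX (ℓ := ℓ) (Mh := Mh) (k := k) (P := P) cq z ≠ 0) : cq ∈ keySet ℓ Mh (D.lev z.1) z.1 := by
  obtain ⟨-, hij, hji, hdown, hup⟩ := fin_data hc
  have hjk := hc.hj.2
  have hu' : hq ((ℓ + 1) ^ cq.1) ((ℓ + 1) * Mh) cq.2 z.1 ≠ 0 := hu
  have hN1 : 1 ≤ (ℓ + 1) ^ cq.1 * ((ℓ + 1) * Mh) := Nat.one_le_iff_ne_zero.2 (by positivity)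
  have hnear : cq.2 ∈ near (bigSide ℓ Mh cq.1) z.1 := by
    refine mem_near_of_abs_lt (one_le_bigSide (le_trans (by norm_num) hMh) cq.1) fun μ => ?_
    have h := abs_lt_of_hq_ne_zero hN1 hu' μ
    have hNM : (ℓ + 1) ^ cq.1 * ((ℓ + 1) * Mh) = bigSide ℓ Mh cq.1 := by rw [bigSide_eq]; ring
    rw [hNM] at h
    have hpos : (0 : ℝ) ≤ ((bigSide ℓ Mh cq.1 : ℕ) : ℝ) := by positivity
    exact h.trans_le (by linarith)
  obtain ⟨b, hb⟩ := img_of_uX_ne_zero hℓ hP hMh cq hc hu (Or.inr rfl)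
  have hwin := window_of_active (D := D) hℓ hR hP hMh hij hjk hc.hq hc.hact hdown hup b
  have hbz : (B6Eq238TwoLevelBox.emb ℓ (fin D cq.1 cq.2) (MhP ℓ Mh cq.1 (fin D cq.1 cq.2)) (Pj ℓ k P cq.1) cq.2
      (one_le_Pj hP cq.1) hc.hq b).1 = z.1 := by
    have h1 : (embC D hP cq hc b).1 = z.1 := by rw [hb]; unfold castP; exact boxCast_symm_apply_val _ _
    exact h1
  rw [hbz] at hwin
  exact mem_keySet (by omega) (by omega) hnear

end CubeNbr

/-! ## §4 The majorant of `∂G′₀` on `𝔅` -/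

section DGMajorant

variable {ℓ Mh k R : ℕ} {P : Fin (d + 1) → ℕ} {D : Domains d ℓ Mh k P R} {a c : ℕ → ℝ}
set_option maxHeartbeats 400000 in
/-- **THE MAJORANT OF `∂G′₀` ON `𝔅` FOR THE GENUINE `k`-LEVEL OPERATOR**: there are `δ₃, A > 0` (functions of `d`, `ℓ`,
windows) such that for every `k`, `M_h ≥ 3`, `R ≥ 2L`, volume, nested family `D`, weights in the windows and axis `μ`,
`|(G′₀λ)(x + e_μ) − (G′₀λ)(x)| ≤ A·L^{j}·e^{−(δ₃/(d+1))·d(y,y′)}|λ|` for `x ∈ B^j(y)`, `supp λ ⊂ B^{j′}(y′)` — per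
term by the product rule, (2.43)₁ at `x + e_μ` and (2.43)₂ at `x` on the cube, `|∂h_□| ≤ (d+1)D₁/L^{j_□}`, the
lattice-unit factors and at most `6·2^{d+1}` terms per bond. [cite: Balaban1984PropagatorsII, (2.66)–(2.67) p.234 (the ∇^ηG′₀ factor «O(1)L^jη»), (2.43) p.230] -/
theorem dMat_gZeroML_majorant (d ℓ : ℕ) (hℓ : 1 ≤ ℓ) (aminus aplus a2minus a2plus : ℝ) (ha : 0 < aminus)
    (ha2 : 0 < a2minus) :
    ∃ δ₃ A : ℝ, 0 < δ₃ ∧ 0 < A ∧ ∀ (k Mh R : ℕ), 3 ≤ Mh → 2 * (ℓ + 1) ≤ R →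
      ∀ (P : Fin (d + 1) → ℕ) (hP : ∀ μ, 1 ≤ P μ) (D : Domains d ℓ Mh k P R) (a c : ℕ → ℝ),
        (∀ i, aminus ≤ a i ∧ a i ≤ aplus) → (∀ i, a2minus ≤ c i ∧ c i ≤ a2plus) →
        ∀ μ : Fin (d + 1),
        HasMajorant (g := geom D) (blkOf D) (Matrix.toLin' (dMat (N0 ℓ Mh k P) μ * gZeroML D a c hP))
          (fun y y' => A * ((ℓ : ℝ) + 1) ^ y.1.1 * Real.exp (-(δ₃ / (d + 1) * (geom D).dist y y'))) := by
  obtain ⟨δ'', c', hδ'', hc', h243⟩ := B6Ineq243TwoLevelBoxL0.ineq243_twoLevel_roww d ℓ hℓ aminus aplus 0 a2minus a2plus ha ha2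
  obtain ⟨δd, cd, hδd, hcd, h243d⟩ := B6Ineq243TwoLevelBoxL0.ineq243_twoLevel_deriv_wsum d ℓ hℓ aminus aplus 0 a2minus a2plus ha ha2
  have hD1 := D1_nonneg contDiff_hprof hasCompactSupport_hprof
  set δ₃ : ℝ := min δ'' δd with hδ₃
  have hδ₃pos : 0 < δ₃ := lt_min hδ'' hδd
  set Q : ℝ := (d + 1) * D1 hprof * (c' * (Real.exp δ'' * Real.exp δ'')) + cd * Real.exp δd with hQ
  have hQ0 : 0 ≤ Q := by positivity
  refine ⟨δ₃, 6 * 2 ^ (d + 1) * Q + 1, hδ₃pos, by positivity, ?_⟩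
  intro k Mh R hMh hR P hP D a c haw hcw μ y' lam B hlam x
  have hMh1 : 1 ≤ Mh := le_trans (by norm_num) hMh
  have hMh2 : 2 ≤ Mh := le_trans (by norm_num) hMh
  have hL1 : (1 : ℝ) ≤ (ℓ : ℝ) + 1 := by linarith [(Nat.cast_nonneg ℓ : (0 : ℝ) ≤ ℓ)]
  have hlamB : ∀ w, |lam w| ≤ B := fun w => BlockSupp.abs_le hlam w
  have hB0 : 0 ≤ B := hlam.nonneg
  rw [Matrix.toLin'_apply, ← Matrix.mulVec_mulVec]
  set dist0 : ℝ := (((bond D).dist (blkOf D x) y' : ℕ) : ℝ) with hdist0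
  have hgeom : (geom D).dist (blkOf D x) y' = dist0 := rfl
  have hlevx : (blkOf D x).1.1 = D.lev x.1 := rfl
  have hdist0nn : 0 ≤ dist0 := by positivity
  have hKnn : 0 ≤ (6 * 2 ^ (d + 1) * Q + 1) * ((ℓ : ℝ) + 1) ^ (blkOf D x).1.1
      * Real.exp (-(δ₃ / (d + 1) * (geom D).dist (blkOf D x) y')) * B := by positivity
  by_cases hxe : x.1 + Pi.single μ 1 ∈ boxDom (N0 ℓ Mh k P)
  swap
  · rw [dMat_mulVec_of_not_mem μ hxe, abs_zero]; exact hKnn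
  rw [dMat_mulVec_of_mem μ hxe]
  set xe : ↥(boxDom (N0 ℓ Mh k P)) := ⟨x.1 + Pi.single μ 1, hxe⟩ with hxedef
  have hxe1 : xe.1 = x.1 + Pi.single μ 1 := rfl
  -- the bound of one term
  set E : ℝ := ((ℓ : ℝ) + 1) ^ D.lev x.1 * (Q * Real.exp (-(δ₃ / (d + 1) * dist0)) * B) with hE
  have hE0 : 0 ≤ E := by positivity
  have hterm : ∀ (cq : ℕ × (Fin (d + 1) → ℤ)) (hc : CubeData D cq),
      |(aX D a c hP cq hc *ᵥ lam) xe - (aX D a c hP cq hc *ᵥ lam) x| ≤ E := by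
    intro cq hc
    obtain ⟨-, hij, hji, -, -⟩ := fin_data hc
    have hjk := hc.hj.2
    by_cases h0 : uX (ℓ := ℓ) (Mh := Mh) (k := k) (P := P) cq x = 0
        ∧ uX (ℓ := ℓ) (Mh := Mh) (k := k) (P := P) cq xe = 0
    · rw [aX_mulVec_apply, aX_mulVec_apply, h0.1, h0.2, zero_mul, zero_mul, sub_zero, abs_zero]; exact hE0
    have hor : uX (ℓ := ℓ) (Mh := Mh) (k := k) (P := P) cq x ≠ 0
        ∨ uX (ℓ := ℓ) (Mh := Mh) (k := k) (P := P) cq xe ≠ 0 := by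
      by_contra h'; push Not at h'; exact h0 ⟨by tauto, by tauto⟩
    -- both ends of the bond lie in the cube image
    have hxe_nb : xe.1 ∈ nbrs x.1 := mem_nbrs.2 ⟨μ, Or.inl hxe1⟩
    have hx_nb : x.1 ∈ nbrs xe.1 := mem_nbrs.2 ⟨μ, Or.inr (by rw [hxe1, add_sub_cancel_right])⟩
    obtain ⟨y, hy⟩ : ∃ y, embC D hP cq hc y = (castP (ℓ := ℓ) (Mh := Mh) (P := P) hij hjk).symm x := by
      rcases hor with h | h
      · exact img_of_uX_ne_zero hℓ hP hMh2 cq hc h (Or.inr rfl)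
      · exact img_of_uX_ne_zero hℓ hP hMh2 cq hc h (Or.inl hx_nb)
    obtain ⟨ye, hye⟩ : ∃ ye, embC D hP cq hc ye = (castP (ℓ := ℓ) (Mh := Mh) (P := P) hij hjk).symm xe := by
      rcases hor with h | h
      · exact img_of_uX_ne_zero hℓ hP hMh2 cq hc h (Or.inl hxe_nb)
      · exact img_of_uX_ne_zero hℓ hP hMh2 cq hc h (Or.inr rfl)
    have hzval : ∀ w : ↥(boxDom (N0 ℓ Mh k P)), ((castP (ℓ := ℓ) (Mh := Mh) (P := P) hij hjk).symm w).1 = w.1 :=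
      fun w => by unfold castP; exact boxCast_symm_apply_val _ _
    have hyx : (embC D hP cq hc y).1 = x.1 := by rw [hy, hzval]
    have hyexe : (embC D hP cq hc ye).1 = xe.1 := by rw [hye, hzval]
    have hyey : ye.1 = y.1 + Pi.single μ 1 := by
      have h1 : (embC D hP cq hc ye).1 - (embC D hP cq hc y).1 = ye.1 - y.1 := by
        unfold embC; exact emb_sub_emb _ hc.hq ye y
      rw [hyexe, hyx, hxe1, add_sub_cancel_left, eq_comm, sub_eq_iff_eq_add'] at h1
      exact h1
    have hxin : InCube ℓ Mh k P cq.1 cq.2 x.1 := by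
      rw [← hzval x]
      exact (inCube_iff_exists_emb (Mh := Mh) hP hij hc.hq _).2 ⟨y, hy⟩
    have hlevwin := lev_window_of_inCube hℓ hR hP hMh2 hc x.2 hxin
    have hMh' : 1 ≤ MhP ℓ Mh cq.1 (fin D cq.1 cq.2) := one_le_MhP hMh1 _ _
    have hcM' : ∀ ν, 1 ≤ cubeM' (MhP ℓ Mh cq.1 (fin D cq.1 cq.2)) (Pj ℓ k P cq.1) cq.2 ν := fun ν =>
      Nat.one_le_iff_ne_zero.2 (Nat.mul_ne_zero_iff.2
        ⟨by omega, by have := (one_le_cubeW (one_le_Pj hP cq.1) hc.hq ν).1; omega⟩)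
    have hn : (0 : ℝ) < (((ℓ + 1) ^ fin D cq.1 cq.2 : ℕ) : ℝ) := by positivity
    have hn1 : (1 : ℝ) ≤ (((ℓ + 1) ^ fin D cq.1 cq.2 : ℕ) : ℝ) := by
      exact_mod_cast Nat.one_le_pow _ _ (by omega)
    have hncast : (((ℓ + 1) ^ fin D cq.1 cq.2 : ℕ) : ℝ) = ((ℓ : ℝ) + 1) ^ fin D cq.1 cq.2 := by push_cast; ring
    set Dd : ℝ := (((ℓ + 1) ^ fin D cq.1 cq.2 : ℕ) : ℝ) * (dist0 / (d + 1) - 1) with hDd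
    -- the vector `u = res(v_□λ ∘ cast)` on the cube, its bound and its support distance from `y`
    have hF : ∀ b, |(res (embC D hP cq hc) *ᵥ ((Matrix.diagonal (vX D cq) *ᵥ lam) ∘ castP (fin_data hc).2.1 hc.hj.2)) b|
        ≤ B := by
      intro b
      rw [res_mulVec, Function.comp_apply, Matrix.mulVec_diagonal, abs_mul]
      calc |vX D cq _| * |lam _| ≤ 1 * B := mul_le_mul (abs_vFun_le_one _ _ _) (hlamB _) (abs_nonneg _) zero_le_one
        _ = B := one_mul _
    have hD : ∀ b, (res (embC D hP cq hc) *ᵥ ((Matrix.diagonal (vX D cq) *ᵥ lam) ∘ castP (fin_data hc).2.1 hc.hj.2)) b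
        ≠ 0 → Dd ≤ supNorm (y.1 - b.1) := by
      intro b hb
      rw [res_mulVec, Function.comp_apply, Matrix.mulVec_diagonal] at hb
      set x'' : ↥(boxDom (N0 ℓ Mh k P)) := castP (fin_data hc).2.1 hc.hj.2 (embC D hP cq hc b) with hx''
      have hμx : lam x'' ≠ 0 := fun h0 => hb (by rw [h0, mul_zero])
      have hx''val : x''.1 = (embC D hP cq hc b).1 := by
        rw [hx'']; unfold castP; exact boxCast_apply_val _ _
      have hx''in : InCube ℓ Mh k P cq.1 cq.2 x''.1 := by
        rw [hx''val]
        exact (inCube_iff_exists_emb (Mh := Mh) hP hij hc.hq _).2 ⟨b, rfl⟩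
      have hblk : blkOf D x'' = y' := by
        by_contra hne
        exact hμx (hlam.off x'' hne)
      have h := Dd_le_supNorm hℓ hR hP hMh2 hc x x'' hxin hx''in y' hblk
      have hsub : x.1 - x''.1 = y.1 - b.1 := by
        rw [hx''val, ← hyx]; unfold embC; exact emb_sub_emb _ hc.hq y b
      rw [hsub] at h
      exact h
    have hD' : ∀ b, (res (embC D hP cq hc) *ᵥ ((Matrix.diagonal (vX D cq) *ᵥ lam) ∘ castP (fin_data hc).2.1 hc.hj.2)) b
        ≠ 0 → Dd - 1 ≤ supNorm (ye.1 - b.1) := by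
      intro b hb
      have h1 := hD b hb
      have h2 := supNorm_sub_le_nbr (x' := b.1) hyey
      linarith
    -- (2.43)₁ at `x + e_μ` on the cube, in the decaying form
    have hrow : roww δ'' ((ℓ + 1) ^ fin D cq.1 cq.2) (cG D a c cq.1 (fin D cq.1 cq.2) cq.2 hP hc.hq) ye ≤ c' :=
      h243 (fin D cq.1 cq.2) (a (fin D cq.1 cq.2)) 0 (c (fin D cq.1 cq.2)) (haw _).1 (haw _).2 le_rfl
        le_rfl (hcw _).1 (hcw _).2 _ hcM' _ ye
    have hval := mulVec_le_of_roww hδ''.le ((ℓ + 1) ^ fin D cq.1 cq.2)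
      (cG D a c cq.1 (fin D cq.1 cq.2) cq.2 hP hc.hq) ye hrow _ hF hD'
    have hval' : |(cG D a c cq.1 (fin D cq.1 cq.2) cq.2 hP hc.hq
          *ᵥ (res (embC D hP cq hc) *ᵥ ((Matrix.diagonal (vX D cq) *ᵥ lam) ∘ castP (fin_data hc).2.1 hc.hj.2))) ye|
        ≤ c' * (Real.exp δ'' * Real.exp δ'') * Real.exp (-(δ₃ / (d + 1) * dist0)) * B := by
      refine hval.trans ?_
      have h1 : Real.exp (-(δ'' * (Dd - 1) / (((ℓ + 1) ^ fin D cq.1 cq.2 : ℕ) : ℝ)))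
          ≤ Real.exp δ'' * Real.exp δ'' * Real.exp (-(δ₃ / (d + 1) * dist0)) := by
        refine (exp_shift_le hδ''.le hn1).trans ?_
        rw [hDd, exp_Dd_eq hn d, mul_assoc]
        exact mul_le_mul_of_nonneg_left (mul_le_mul_of_nonneg_left
          (exp_rate_mono (min_le_left _ _) hdist0nn d) (Real.exp_pos _).le) (Real.exp_pos _).le
      calc c' * Real.exp (-(δ'' * (Dd - 1) / (((ℓ + 1) ^ fin D cq.1 cq.2 : ℕ) : ℝ))) * B
          ≤ c' * (Real.exp δ'' * Real.exp δ'' * Real.exp (-(δ₃ / (d + 1) * dist0))) * B :=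
            mul_le_mul_of_nonneg_right (mul_le_mul_of_nonneg_left h1 hc'.le) hB0
        _ = c' * (Real.exp δ'' * Real.exp δ'') * Real.exp (-(δ₃ / (d + 1) * dist0)) * B := by ring
    -- (2.43)₂ at `x` on the cube, in the decaying form
    have hwrow := h243d (fin D cq.1 cq.2) (a (fin D cq.1 cq.2)) 0 (c (fin D cq.1 cq.2)) (haw _).1
      (haw _).2 le_rfl le_rfl (hcw _).1 (hcw _).2 _ hcM'
      (lamLoc ℓ (MhP ℓ Mh cq.1 (fin D cq.1 cq.2)) (Pj ℓ k P cq.1) cq.2 (one_le_Pj hP cq.1) hc.hq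
        (LamG D cq.1 (fin D cq.1 cq.2))) μ y ye hyey
    have hder := sum_mul_le_of_wrow hn hB0
      (fun z => (((ℓ + 1) ^ fin D cq.1 cq.2 : ℕ) : ℝ)
        * (cG D a c cq.1 (fin D cq.1 cq.2) cq.2 hP hc.hq ye z - cG D a c cq.1 (fin D cq.1 cq.2) cq.2 hP hc.hq y z))
      (res (embC D hP cq hc) *ᵥ ((Matrix.diagonal (vX D cq) *ᵥ lam) ∘ castP (fin_data hc).2.1 hc.hj.2))
      (fun z => supNorm (y.1 - z.1)) hwrow hF hD hδd.le
    have hder' : |(((ℓ + 1) ^ fin D cq.1 cq.2 : ℕ) : ℝ)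
          * ((cG D a c cq.1 (fin D cq.1 cq.2) cq.2 hP hc.hq
              *ᵥ (res (embC D hP cq hc) *ᵥ ((Matrix.diagonal (vX D cq) *ᵥ lam) ∘ castP (fin_data hc).2.1 hc.hj.2))) ye
            - (cG D a c cq.1 (fin D cq.1 cq.2) cq.2 hP hc.hq
              *ᵥ (res (embC D hP cq hc) *ᵥ ((Matrix.diagonal (vX D cq) *ᵥ lam) ∘ castP (fin_data hc).2.1 hc.hj.2))) y)|
        ≤ cd * Real.exp δd * Real.exp (-(δ₃ / (d + 1) * dist0)) * B := by
      have hsum : (((ℓ + 1) ^ fin D cq.1 cq.2 : ℕ) : ℝ)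
          * ((cG D a c cq.1 (fin D cq.1 cq.2) cq.2 hP hc.hq
              *ᵥ (res (embC D hP cq hc) *ᵥ ((Matrix.diagonal (vX D cq) *ᵥ lam) ∘ castP (fin_data hc).2.1 hc.hj.2))) ye
            - (cG D a c cq.1 (fin D cq.1 cq.2) cq.2 hP hc.hq
              *ᵥ (res (embC D hP cq hc) *ᵥ ((Matrix.diagonal (vX D cq) *ᵥ lam) ∘ castP (fin_data hc).2.1 hc.hj.2))) y)
          = ∑ z, (((ℓ + 1) ^ fin D cq.1 cq.2 : ℕ) : ℝ)
              * (cG D a c cq.1 (fin D cq.1 cq.2) cq.2 hP hc.hq ye z - cG D a c cq.1 (fin D cq.1 cq.2) cq.2 hP hc.hq y z)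
              * (res (embC D hP cq hc) *ᵥ ((Matrix.diagonal (vX D cq) *ᵥ lam) ∘ castP (fin_data hc).2.1 hc.hj.2)) z := by
        simp only [Matrix.mulVec, dotProduct]
        rw [← Finset.sum_sub_distrib, Finset.mul_sum]
        refine Finset.sum_congr rfl fun z _ => ?_
        ring
      rw [hsum]
      refine hder.trans ?_
      have h1 : Real.exp (-(δd * Dd / (((ℓ + 1) ^ fin D cq.1 cq.2 : ℕ) : ℝ)))
          ≤ Real.exp δd * Real.exp (-(δ₃ / (d + 1) * dist0)) := by
        rw [hDd, exp_Dd_eq hn d]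
        exact mul_le_mul_of_nonneg_left (exp_rate_mono (min_le_right _ _) hdist0nn d) (Real.exp_pos _).le
      calc cd * Real.exp (-(δd * Dd / (((ℓ + 1) ^ fin D cq.1 cq.2 : ℕ) : ℝ))) * B
          ≤ cd * (Real.exp δd * Real.exp (-(δ₃ / (d + 1) * dist0))) * B :=
            mul_le_mul_of_nonneg_right (mul_le_mul_of_nonneg_left h1 hcd.le) hB0
        _ = cd * Real.exp δd * Real.exp (-(δ₃ / (d + 1) * dist0)) * B := by ring
    -- `|h_□| ≤ 1`, `|∂h_□| ≤ (d+1)D₁/L^{j_□}`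
    have huXx : |uX (ℓ := ℓ) (Mh := Mh) (k := k) (P := P) cq x| ≤ 1 := abs_hq_le_one _ _ _ _
    have hNj1 : 1 ≤ (ℓ + 1) ^ cq.1 := Nat.one_le_pow _ _ (by omega)
    have hM1 : 1 ≤ (ℓ + 1) * Mh := by nlinarith
    have hdu : |uX (ℓ := ℓ) (Mh := Mh) (k := k) (P := P) cq xe - uX (ℓ := ℓ) (Mh := Mh) (k := k) (P := P) cq x|
        ≤ (d + 1) * D1 hprof / (((ℓ + 1) ^ cq.1 : ℕ) : ℝ) := by
      have h := abs_hq_sub_le (d := d) hNj1 hM1 cq.2 x.1 xe.1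
      have hs : supNorm (xe.1 - x.1) ≤ 1 := by
        rw [hxe1, add_sub_cancel_left]; exact supNorm_single_le μ
      have hMr : (1 : ℝ) ≤ (((ℓ + 1) * Mh : ℕ) : ℝ) := by exact_mod_cast hM1
      have hnj : (0 : ℝ) < (((ℓ + 1) ^ cq.1 : ℕ) : ℝ) := by positivity
      have hA0 : 0 ≤ (d + 1) * D1 hprof / (((ℓ + 1) * Mh : ℕ) : ℝ) := by positivity
      have h5 : (d + 1) * D1 hprof / (((ℓ + 1) * Mh : ℕ) : ℝ) * supNorm (xe.1 - x.1) ≤ (d + 1) * D1 hprof :=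
        calc (d + 1) * D1 hprof / (((ℓ + 1) * Mh : ℕ) : ℝ) * supNorm (xe.1 - x.1)
            ≤ (d + 1) * D1 hprof / (((ℓ + 1) * Mh : ℕ) : ℝ) * 1 := mul_le_mul_of_nonneg_left hs hA0
          _ = (d + 1) * D1 hprof / (((ℓ + 1) * Mh : ℕ) : ℝ) := mul_one _
          _ ≤ (d + 1) * D1 hprof := div_le_self (by positivity) hMr
      exact h.trans (div_le_div_of_nonneg_right h5 hnj.le)
    -- the lattice-unit factors `n²/L^{j_□} ≤ n ≤ L^{lev x}`
    have hnle : (((ℓ + 1) ^ fin D cq.1 cq.2 : ℕ) : ℝ) ≤ ((ℓ : ℝ) + 1) ^ D.lev x.1 := by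
      rw [hncast]; exact pow_le_pow_right₀ hL1 hlevwin.1
    have hsq : (((ℓ + 1) ^ fin D cq.1 cq.2 : ℕ) : ℝ) * (((ℓ + 1) ^ fin D cq.1 cq.2 : ℕ) : ℝ)
        / (((ℓ + 1) ^ cq.1 : ℕ) : ℝ) ≤ ((ℓ : ℝ) + 1) ^ D.lev x.1 := by
      have hnj : (0 : ℝ) < (((ℓ + 1) ^ cq.1 : ℕ) : ℝ) := by positivity
      have h2 : (((ℓ + 1) ^ cq.1 : ℕ) : ℝ) = ((ℓ : ℝ) + 1) ^ cq.1 := by push_cast; ring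
      rw [div_le_iff₀ hnj, hncast, ← pow_add, h2, ← pow_add]
      exact pow_le_pow_right₀ hL1 (by omega)
    -- assembling the product rule
    rw [aX_mulVec_apply, aX_mulVec_apply, gX_row_img hP cq hc _ hye, gX_row_img hP cq hc _ hy]
    obtain ⟨gye, hgye⟩ : ∃ t : ℝ, t = (cG D a c cq.1 (fin D cq.1 cq.2) cq.2 hP hc.hq
        *ᵥ (res (embC D hP cq hc) *ᵥ ((Matrix.diagonal (vX D cq) *ᵥ lam) ∘ castP (fin_data hc).2.1 hc.hj.2))) ye :=
      ⟨_, rfl⟩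
    obtain ⟨gy, hgy⟩ : ∃ t : ℝ, t = (cG D a c cq.1 (fin D cq.1 cq.2) cq.2 hP hc.hq
        *ᵥ (res (embC D hP cq hc) *ᵥ ((Matrix.diagonal (vX D cq) *ᵥ lam) ∘ castP (fin_data hc).2.1 hc.hj.2))) y :=
      ⟨_, rfl⟩
    rw [← hgye] at hval' hder' ⊢
    rw [← hgy] at hder' ⊢
    obtain ⟨nn, hnn⟩ : ∃ t : ℝ, t = (((ℓ + 1) ^ fin D cq.1 cq.2 : ℕ) : ℝ) := ⟨_, rfl⟩
    have hn2eq : ((((ℓ : ℝ) + 1)) ^ fin D cq.1 cq.2) ^ 2 = nn * nn := by rw [hnn, hncast]; ring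
    rw [← hnn] at hder' hnle hsq
    rw [hn2eq]
    have hnn0 : 0 ≤ nn := by rw [hnn]; positivity
    have hsplit : uX (ℓ := ℓ) (Mh := Mh) (k := k) (P := P) cq xe * (nn * nn * gye)
          - uX (ℓ := ℓ) (Mh := Mh) (k := k) (P := P) cq x * (nn * nn * gy)
        = (uX (ℓ := ℓ) (Mh := Mh) (k := k) (P := P) cq xe - uX (ℓ := ℓ) (Mh := Mh) (k := k) (P := P) cq x)
            * (nn * nn * gye)
          + uX (ℓ := ℓ) (Mh := Mh) (k := k) (P := P) cq x * (nn * (nn * (gye - gy))) := by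
      ring
    rw [hsplit]
    have hR1 : 0 ≤ c' * (Real.exp δ'' * Real.exp δ'') * Real.exp (-(δ₃ / (d + 1) * dist0)) * B := by positivity
    have hR2 : 0 ≤ cd * Real.exp δd * Real.exp (-(δ₃ / (d + 1) * dist0)) * B := by positivity
    have hA1 : |(uX (ℓ := ℓ) (Mh := Mh) (k := k) (P := P) cq xe - uX (ℓ := ℓ) (Mh := Mh) (k := k) (P := P) cq x)
          * (nn * nn * gye)|
        ≤ ((ℓ : ℝ) + 1) ^ D.lev x.1
            * ((d + 1) * D1 hprof * (c' * (Real.exp δ'' * Real.exp δ'')) * Real.exp (-(δ₃ / (d + 1) * dist0)) * B) := by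
      rw [abs_mul, abs_mul, abs_of_nonneg (mul_nonneg hnn0 hnn0)]
      have hdu0 : 0 ≤ (d + 1) * D1 hprof / (((ℓ + 1) ^ cq.1 : ℕ) : ℝ) := by positivity
      calc |uX cq xe - uX cq x| * (nn * nn * |gye|)
          ≤ ((d + 1) * D1 hprof / (((ℓ + 1) ^ cq.1 : ℕ) : ℝ))
              * (nn * nn * (c' * (Real.exp δ'' * Real.exp δ'') * Real.exp (-(δ₃ / (d + 1) * dist0)) * B)) :=
            mul_le_mul hdu (mul_le_mul_of_nonneg_left hval' (mul_nonneg hnn0 hnn0)) (by positivity) hdu0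
        _ = (nn * nn / (((ℓ + 1) ^ cq.1 : ℕ) : ℝ))
              * ((d + 1) * D1 hprof * (c' * (Real.exp δ'' * Real.exp δ'')) * Real.exp (-(δ₃ / (d + 1) * dist0)) * B) := by
            ring
        _ ≤ ((ℓ : ℝ) + 1) ^ D.lev x.1
              * ((d + 1) * D1 hprof * (c' * (Real.exp δ'' * Real.exp δ'')) * Real.exp (-(δ₃ / (d + 1) * dist0)) * B) :=
            mul_le_mul_of_nonneg_right hsq (by positivity)
    have hA2 : |uX (ℓ := ℓ) (Mh := Mh) (k := k) (P := P) cq x * (nn * (nn * (gye - gy)))|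
        ≤ ((ℓ : ℝ) + 1) ^ D.lev x.1 * (cd * Real.exp δd * Real.exp (-(δ₃ / (d + 1) * dist0)) * B) := by
      rw [abs_mul, abs_mul, abs_of_nonneg hnn0]
      calc |uX cq x| * (nn * |nn * (gye - gy)|)
          ≤ 1 * (((ℓ : ℝ) + 1) ^ D.lev x.1 * (cd * Real.exp δd * Real.exp (-(δ₃ / (d + 1) * dist0)) * B)) :=
            mul_le_mul huXx (mul_le_mul hnle hder' (abs_nonneg _) (by positivity)) (by positivity) zero_le_one
        _ = ((ℓ : ℝ) + 1) ^ D.lev x.1 * (cd * Real.exp δd * Real.exp (-(δ₃ / (d + 1) * dist0)) * B) := one_mul _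
    refine (abs_add_le _ _).trans ?_
    rw [hE, hQ]
    have := add_le_add hA1 hA2
    refine this.trans (le_of_eq ?_)
    ring
  -- summing over the cover
  unfold gZeroML
  rw [Matrix.sum_mulVec, Finset.sum_apply, Finset.sum_apply, ← Finset.sum_sub_distrib, Finset.attach_eq_univ]
  refine (Finset.abs_sum_le_sum_abs _ _).trans ?_
  -- the members with a non-zero term: `h_□(x) ≠ 0` or `h_□(x + e_μ) ≠ 0`
  obtain ⟨T, hTsub, hTcard⟩ : ∃ T : Finset (ℕ × (Fin (d + 1) → ℤ)),
      (∀ cq, cq ∈ keySet ℓ Mh (D.lev x.1) x.1 ∨ cq ∈ keySet ℓ Mh (D.lev xe.1) xe.1 → cq ∈ T)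
        ∧ (T.card : ℝ) ≤ 6 * 2 ^ (d + 1) := by
    refine ⟨keySet ℓ Mh (D.lev x.1) x.1 ∪ keySet ℓ Mh (D.lev xe.1) xe.1, fun cq h => Finset.mem_union.2 h, ?_⟩
    have h1 := Finset.card_union_le (keySet ℓ Mh (D.lev x.1) x.1) (keySet ℓ Mh (D.lev xe.1) xe.1)
    have h2 := card_keySet_le ℓ Mh (D.lev x.1) x.1
    have h3 := card_keySet_le ℓ Mh (D.lev xe.1) xe.1
    have h4 : (keySet ℓ Mh (D.lev x.1) x.1 ∪ keySet ℓ Mh (D.lev xe.1) xe.1).card ≤ 6 * 2 ^ (d + 1) :=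
      h1.trans (by omega)
    exact_mod_cast h4
  have key := sum_le_card_mul
    (fun cq : {cq // cq ∈ cubeSet D} =>
      |(aX D a c hP cq.1 (cubeData_of_mem cq.2) *ᵥ lam) xe - (aX D a c hP cq.1 (cubeData_of_mem cq.2) *ᵥ lam) x|)
    (fun cq => cq.1) Subtype.val_injective T
    (fun cq hq0 => by
      by_contra hmem
      apply hq0
      have hux : uX (ℓ := ℓ) (Mh := Mh) (k := k) (P := P) cq.1 x = 0 := by
        by_contra h
        exact hmem (hTsub _ (Or.inl (mem_keySet_of_uX_ne_zero hℓ hR hP hMh2 cq.1 (cubeData_of_mem cq.2) h)))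
      have huxe : uX (ℓ := ℓ) (Mh := Mh) (k := k) (P := P) cq.1 xe = 0 := by
        by_contra h
        exact hmem (hTsub _ (Or.inr (mem_keySet_of_uX_ne_zero hℓ hR hP hMh2 cq.1 (cubeData_of_mem cq.2) h)))
      rw [aX_mulVec_apply, aX_mulVec_apply, hux, huxe, zero_mul, zero_mul, sub_zero, abs_zero])
    hE0 (fun cq => hterm cq.1 (cubeData_of_mem cq.2))
  refine key.trans ?_
  dsimp only
  rw [hgeom, hlevx]
  have hrest : 0 ≤ ((ℓ : ℝ) + 1) ^ D.lev x.1 * Real.exp (-(δ₃ / (d + 1) * dist0)) * B := by positivity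
  calc (T.card : ℝ) * E ≤ 6 * 2 ^ (d + 1) * E := mul_le_mul_of_nonneg_right hTcard hE0
    _ = 6 * 2 ^ (d + 1) * Q * (((ℓ : ℝ) + 1) ^ D.lev x.1 * Real.exp (-(δ₃ / (d + 1) * dist0)) * B) := by
        rw [hE]; ring
    _ ≤ (6 * 2 ^ (d + 1) * Q + 1) * (((ℓ : ℝ) + 1) ^ D.lev x.1 * Real.exp (-(δ₃ / (d + 1) * dist0)) * B) :=
        mul_le_mul_of_nonneg_right (by linarith) hrest
    _ = (6 * 2 ^ (d + 1) * Q + 1) * ((ℓ : ℝ) + 1) ^ D.lev x.1 * Real.exp (-(δ₃ / (d + 1) * dist0)) * B := by ring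

end DGMajorant

/-! ## §5 Proposition 2.2, second entry, for the genuine `k`-level operator -/

section Prop22

variable {ℓ Mh k R : ℕ} {P : Fin (d + 1) → ℕ}

/-- **THE DIFFERENTIATED FIXED POINT `∂G′ = ∂G′₀ + (∂G′)R`** of (2.38)/(2.50) for the genuine operator, as linear maps.
[cite: Balaban1984PropagatorsII, (2.38) p.229, (2.50) p.232, (2.66) p.234] -/
theorem fixedPoint_dMat_gml (D : Domains d ℓ Mh k P R) {a c : ℕ → ℝ} (hℓ : 1 ≤ ℓ) (hR : 2 * (ℓ + 1) ≤ R)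
    (hP : ∀ μ, 1 ≤ P μ) (hMh : 2 ≤ Mh) (ha : ∀ i, 0 < a i) (hcpos : ∀ i, 0 < c i)
    (hac : ∀ i, a (i + 1) = aNext ℓ (a i) (c i)) (μ : Fin (d + 1)) :
    Matrix.toLin' (dMat (N0 ℓ Mh k P) μ * gml (N0 ℓ Mh k P) ℓ k D.lev a)
      = Matrix.toLin' (dMat (N0 ℓ Mh k P) μ * gZeroML D a c hP)
        + Matrix.toLin' (dMat (N0 ℓ Mh k P) μ * gml (N0 ℓ Mh k P) ℓ k D.lev a) * Matrix.toLin' (rML D a c hP) := by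
  have h238 := eq238_multiLevelBox (D := D) (a := a) (c := c) hℓ hR hP hMh ha hcpos hac
  have hGE : gml (N0 ℓ Mh k P) ℓ k D.lev a * mlOp (N0 ℓ Mh k P) ℓ k D.lev a = 1 :=
    gml_mul_mlOp (fun ν => Nat.one_le_iff_ne_zero.2 (by have := hP ν; positivity)) D.lev_le ha
  have hmat : gml (N0 ℓ Mh k P) ℓ k D.lev a
      = gZeroML D a c hP + gml (N0 ℓ Mh k P) ℓ k D.lev a * rML D a c hP := by
    have h := congrArg (fun T => gml (N0 ℓ Mh k P) ℓ k D.lev a * T) h238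
    rw [← Matrix.mul_assoc, hGE, Matrix.one_mul, Matrix.mul_sub, Matrix.mul_one] at h
    rw [h]; abel
  have hmat' : dMat (N0 ℓ Mh k P) μ * gml (N0 ℓ Mh k P) ℓ k D.lev a
      = dMat (N0 ℓ Mh k P) μ * gZeroML D a c hP
        + dMat (N0 ℓ Mh k P) μ * gml (N0 ℓ Mh k P) ℓ k D.lev a * rML D a c hP := by
    conv_lhs => rw [hmat]
    rw [Matrix.mul_add, Matrix.mul_assoc]
  conv_lhs => rw [hmat']
  rw [map_add, Module.End.mul_eq_comp, ← Matrix.toLin'_mul]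

/-- **[B6] PROPOSITION 2.2, SECOND ENTRY OF (2.67) (`∇^η_xG′λ`), FOR THE GENUINE `k`-LEVEL OPERATOR `G′ = Δ′_a^{−1}`
ON A BOX**: there are `δ₀, C, M₀ > 0` and `N₀ ≥ 1` (functions of `d`, `ℓ` and the windows) such that for EVERY number
of levels `k`, `M_h ≥ 3` with `L·M_h ≥ M₀` («M is sufficiently large»), `R ≥ 2L` with `RM ≥ N₀ + 1` ((2.59)),
volume `P`, nested family `D` of domains (2.1)–(2.2), weights `a_i ∈ [a₋, a₊]`, `c_i ∈ [c₋, c₊]` with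
`a_{i+1} = aNext ℓ a_i c_i`, and every axis `μ`:
`|(G′λ)(x + e_μ) − (G′λ)(x)| ≤ C·L^{j}·e^{−½δ₀d(y,y′)}·|λ|` for `x, x + e_μ` in the box, `x ∈ B^j(y)`, `y ∈ Λ_j`,
`supp λ ⊂ B^{j′}(y′)` (`HasMajorant` of `∂_μG′`; lattice units: `L^{j}` for «L^jη») — by the printed route applied
to the differentiated fixed point `∂G′ = ∂G′₀ + (∂G′)R`: the majorants of `R` ((2.64), file 5) and of `∂G′₀` (§4),
Lemma 2.1 on the box (file 4) and the chain (2.64)–(2.66) (`B6Prop23Chain.majorant_of_fixedPoint_266W`).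
[cite: Balaban1984PropagatorsII, Proposition 2.2 (2.67) p.234 (second entry), (2.64)–(2.66) p.234] -/
theorem prop22_second_multiLevelBox (d ℓ : ℕ) (hℓ : 1 ≤ ℓ) (aminus aplus a2minus a2plus : ℝ) (ha : 0 < aminus)
    (ha2 : 0 < a2minus) :
    ∃ δ₀ C M₀ : ℝ, ∃ N₀ : ℕ, 0 < δ₀ ∧ 0 < C ∧ 0 < M₀ ∧ 0 < N₀ ∧
      ∀ (k Mh R : ℕ), 3 ≤ Mh → M₀ ≤ ((ℓ : ℝ) + 1) * Mh → 2 * (ℓ + 1) ≤ R → N₀ + 1 ≤ R * ((ℓ + 1) * Mh) →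
      ∀ (P : Fin (d + 1) → ℕ) (hP : ∀ μ, 1 ≤ P μ) (D : Domains d ℓ Mh k P R) (a c : ℕ → ℝ),
        (∀ i, aminus ≤ a i ∧ a i ≤ aplus) → (∀ i, a2minus ≤ c i ∧ c i ≤ a2plus) →
        (∀ i, a (i + 1) = aNext ℓ (a i) (c i)) → ∀ μ : Fin (d + 1),
        HasMajorant (g := geom D) (blkOf D)
          (Matrix.toLin' (dMat (N0 ℓ Mh k P) μ * gml (N0 ℓ Mh k P) ℓ k D.lev a))
          (fun y y' => C * ((ℓ : ℝ) + 1) ^ y.1.1 * Real.exp (-(δ₀ / 2 * (geom D).dist y y'))) := by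
  obtain ⟨δ₁, K, hδ₁, hK, hRmaj⟩ := rML_majorant d ℓ hℓ aminus aplus a2minus a2plus ha ha2
  obtain ⟨δ₂, A, hδ₂, hA, hGmaj⟩ := dMat_gZeroML_majorant d ℓ hℓ aminus aplus a2minus a2plus ha ha2
  have hL0 : (0 : ℝ) < (ℓ : ℝ) + 1 := by positivity
  have hL1 : (1 : ℝ) ≤ (ℓ : ℝ) + 1 := by linarith [(Nat.cast_nonneg ℓ : (0 : ℝ) ≤ ℓ)]
  -- the rate `δ₀ = min(δ₁, δ₂)/(d+1)` and the (2.59)-threshold `N₀`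
  set δ₀ : ℝ := min δ₁ δ₂ / (d + 1) with hδ₀
  have hδ₀pos : 0 < δ₀ := by rw [hδ₀]; exact div_pos (lt_min hδ₁ hδ₂) (by positivity)
  set N₀ : ℕ := ⌈4 * ((d : ℝ) + 1) * ((ℓ : ℝ) + 1) / (1 / 2 * δ₀)⌉₊ + 1 with hN₀
  have hN₀pos : 0 < N₀ := by rw [hN₀]; omega
  have hθlt : Real.exp (-(1 / 2 * δ₀)) * ((ℓ : ℝ) + 1) ^ ((2 * (d + 1 : ℕ) : ℝ) / N₀) < 1 := by
    refine theta_lt_one_of_log hL0 hN₀pos ?_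
    have hlog : Real.log ((ℓ : ℝ) + 1) ≤ (ℓ : ℝ) + 1 := (Real.log_le_sub_one_of_pos hL0).trans (by linarith)
    have hN₀ge : 4 * ((d : ℝ) + 1) * ((ℓ : ℝ) + 1) / (1 / 2 * δ₀) < (N₀ : ℝ) := by
      rw [hN₀]; push_cast
      exact lt_of_le_of_lt (Nat.le_ceil _) (by linarith)
    have hσ : (0 : ℝ) < 1 / 2 * δ₀ := by positivity
    rw [div_lt_iff₀ hσ] at hN₀ge
    push_cast
    nlinarith [mul_nonneg (by positivity : (0 : ℝ) ≤ 2 * ((d : ℝ) + 1)) (Real.log_nonneg hL1)]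
  -- the (2.61)-constant and «M sufficiently large»
  set cK : ℝ := K261 N₀ (d + 1) ((ℓ : ℝ) + 1) 1 (1 / 2 * δ₀) with hcK
  have hcK0 : 0 ≤ cK := K261_nonneg (by positivity) zero_le_one
  set M₀ : ℝ := 2 * K * cK + 1 with hM₀
  refine ⟨δ₀, 2 * A * cK + 1, M₀, N₀, hδ₀pos, by positivity, by positivity, hN₀pos, ?_⟩
  intro k Mh R hMh hM hR hRM P hP D a c haw hcw hac μ
  have hMh1 : 1 ≤ Mh := le_trans (by norm_num) hMh
  have hMh2 : 2 ≤ Mh := le_trans (by norm_num) hMh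
  have hMpos : (0 : ℝ) < ((ℓ : ℝ) + 1) * Mh := by
    have : (1 : ℝ) ≤ Mh := by exact_mod_cast hMh1
    positivity
  -- the majorants of `R` and `∂G′₀`, at the common rate `δ₀`
  set θ : ℝ := K / (((ℓ : ℝ) + 1) * Mh) with hθ
  have hθ0 : 0 ≤ θ := by positivity
  have hdnn : ∀ y y' : (geom D).Site, 0 ≤ (geom D).dist y y' := (triangle_refl_nonneg D hMh1 hP).2.2
  have hrate : ∀ (δ : ℝ), min δ₁ δ₂ ≤ δ → ∀ y y' : (geom D).Site,
      Real.exp (-(δ / (d + 1) * (geom D).dist y y')) ≤ Real.exp (-(δ₀ * (geom D).dist y y')) := by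
    intro δ hδ y y'
    rw [Real.exp_le_exp, hδ₀, neg_le_neg_iff]
    exact mul_le_mul_of_nonneg_right (div_le_div_of_nonneg_right hδ (by positivity)) (hdnn y y')
  have hRm : HasMajorant (g := geom D) (blkOf D) (Matrix.toLin' (rML D a c hP))
      (fun y y' => θ * Real.exp (-(δ₀ * (geom D).dist y y'))) :=
    hasMajorant_mono (blkOf D) (hRmaj k Mh R hMh hR P hP D a c haw hcw) fun y y' =>
      mul_le_mul_of_nonneg_left (hrate δ₁ (min_le_left _ _) y y') hθ0
  have hGm : HasMajorant (g := geom D) (blkOf D) (Matrix.toLin' (dMat (N0 ℓ Mh k P) μ * gZeroML D a c hP))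
      (fun y y' => A * ((ℓ : ℝ) + 1) ^ y.1.1 * Real.exp (-(δ₀ * (geom D).dist y y'))) :=
    hasMajorant_mono (blkOf D) (hGmaj k Mh R hMh hR P hP D a c haw hcw μ) fun y y' =>
      mul_le_mul_of_nonneg_left (hrate δ₂ (min_le_right _ _) y y') (by positivity)
  -- Lemma 2.1 on the box with `α = ½`
  obtain ⟨-, h261, -, h263⟩ := lemma21_box D hMh1 hP hN₀pos hRM hδ₀pos.le (α := 1 / 2) (by norm_num)
    (by norm_num) hθlt
  obtain ⟨htri, hrefl, -⟩ := triangle_refl_nonneg D hMh1 hP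
  -- the smallness `θ·c < 1` from `M ≥ M₀`
  have hsmall : θ * cK ≤ 1 / 2 := by
    rw [hθ, div_mul_eq_mul_div, div_le_iff₀ hMpos]
    have : 2 * K * cK + 1 ≤ ((ℓ : ℝ) + 1) * Mh := hM
    nlinarith
  have hsmall' : θ * cK < 1 := by linarith
  -- the differentiated fixed point and the chain
  have hfix := fixedPoint_dMat_gml D (c := c) hℓ hR hP hMh2 (fun i => lt_of_lt_of_le ha (haw i).1)
    (fun i => lt_of_lt_of_le ha2 (hcw i).1) hac μ
  have hchain := majorant_of_fixedPoint_266W (g := geom D) (blkOf D) cK δ₀ (1 / 2) θ A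
    (fun y => ((ℓ : ℝ) + 1) ^ y.1.1) hA.le (fun y => by positivity) hθ0 hcK0
    (by nlinarith [hδ₀pos.le] : (0 : ℝ) ≤ (1 - 1 / 2) * δ₀) htri hrefl hdnn h261 h263 hsmall' hGm hRm hfix
  refine hasMajorant_mono (g := geom D) (blkOf D) hchain fun y y' => ?_
  have hinv : (1 - θ * cK)⁻¹ ≤ 2 := by
    rw [inv_le_comm₀ (by linarith) (by norm_num)]; linarith
  have hexp0 : 0 ≤ Real.exp (-((1 - 1 / 2) * δ₀ * (geom D).dist y y')) := (Real.exp_pos _).le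
  have hP0 : 0 ≤ ((ℓ : ℝ) + 1) ^ y.1.1 := by positivity
  have hrate2 : Real.exp (-((1 - 1 / 2) * δ₀ * (geom D).dist y y')) = Real.exp (-(δ₀ / 2 * (geom D).dist y y')) := by
    congr 1; ring
  rw [← hrate2]
  have h1 : A * cK * (1 - θ * cK)⁻¹ ≤ 2 * A * cK + 1 := by
    have : A * cK * (1 - θ * cK)⁻¹ ≤ A * cK * 2 := mul_le_mul_of_nonneg_left hinv (by positivity)
    linarith
  calc A * cK * (1 - θ * cK)⁻¹ * ((ℓ : ℝ) + 1) ^ y.1.1 * Real.exp (-((1 - 1 / 2) * δ₀ * (geom D).dist y y'))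
      = A * cK * (1 - θ * cK)⁻¹ * (((ℓ : ℝ) + 1) ^ y.1.1 * Real.exp (-((1 - 1 / 2) * δ₀ * (geom D).dist y y'))) := by
        ring
    _ ≤ (2 * A * cK + 1) * (((ℓ : ℝ) + 1) ^ y.1.1 * Real.exp (-((1 - 1 / 2) * δ₀ * (geom D).dist y y'))) :=
        mul_le_mul_of_nonneg_right h1 (mul_nonneg hP0 hexp0)
    _ = (2 * A * cK + 1) * ((ℓ : ℝ) + 1) ^ y.1.1 * Real.exp (-((1 - 1 / 2) * δ₀ * (geom D).dist y y')) := by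
        ring

end Prop22

end

end Literature.MathematicalPhysics.QuantumFieldTheory.Balaban1983to89.B6Prop22DerivMultiLevelBoxL0
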